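import Mathlib
import Literature.NumberTheory.Transcendental.BakerLogarithmsConclusion
import Literature.NumberTheory.Transcendental.QuadraticRelationsLogarithmsBakerProofs
import Summits.KontsevichZagierPeriods.KontsevichZagierPeriods.Theses.InverseLandau

/-!
# `TateLifting`, line `Sketch`, stub `stub_bakerDecomposition` — Baker: algebraic relations among real logarithms are spanned by multiplicative ones

Crux stmt-KontsevichZagierPeriods-9129 (`Summit.KontsevichZagierPeriods.KontsevichZagierPeriods.Theses.InverseLandau.TateLifting`),
weight-one sector. If `α₁,…,α_s > 0` are real algebraic, `w₁,…,w_s` are real algebraic and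
`Σ wᵢ log αᵢ = 0`, then the coefficient vector `w` is an algebraic linear combination of INTEGER
vectors `M_q ∈ ℤ^s` that are multiplicative relations `Π αᵢ^{M_q i} = 1`.

Proof: choose a maximal `ℚ`-linearly independent subfamily `(log α_j)_{j ∈ J}`
(`exists_linearIndepOn_extension`): for every `i` there are rationals `r_ij` (`j ∈ J`) with
`log αᵢ = Σ_j r_ij log α_j`; clearing denominators (`D ≠ 0`, `n_ij = D r_ij ∈ ℤ`) the integer
vector `M_i := D e_i − Σ_j n_ij e_j` is a multiplicative relation (exponentiate:
`αᵢ^D = Π α_j^{n_ij}`, `Real.exp_log`). Rewriting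
`Σ wᵢ log αᵢ = Σ_{j∈J} (Σ_i wᵢ r_ij) log α_j`, BAKER'S THEOREM — PROVED in the tree as
`Literature.NumberTheory.Transcendental.baker_holds` (qualitative form: `ℚ`-linearly independent
logarithms of algebraic numbers are, together with `1`, linearly independent over `ℚ̄`; apply it in
`ℂ` to `l j := (Real.log (α j) : ℂ)`, `cexp (l j) = α j` algebraic, through
`RoyWaldschmidt1997.eq_zero_of_sum_algebraic_mul_eq_zero`) — forces every coefficient
`Σ_i wᵢ r_ij` to vanish, so `w = Σ_i (wᵢ/D) · M_i`, with algebraic coefficients `wᵢ/D`.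
-/

noncomputable section

namespace Summit.KontsevichZagierPeriods.InverseLandau

open Literature.NumberTheory.Transcendental

/-! ### Baker's theorem, repackaged for finite index types and real logarithms -/

/-- **Baker, homogeneous form, any finite index type**: if `∑ aᵢ λᵢ = 0` with all `aᵢ` algebraic
and the `λᵢ` `ℚ`-linearly independent logarithms of algebraic numbers, then every `aᵢ = 0`
(`RoyWaldschmidt1997.eq_zero_of_sum_algebraic_mul_eq_zero`, reindexed along `Fintype.equivFin`).
[cite: Baker1975, Thm 2.1] -/
theorem tateLifting_baker_fintype {ι : Type*} [Fintype ι] {l a : ι → ℂ}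
    (hl : ∀ i, IsAlgebraic ℚ (Complex.exp (l i))) (hli : LinearIndependent ℚ l)
    (ha : ∀ i, IsAlgebraic ℚ (a i)) (h : ∑ i, a i * l i = 0) (i : ι) : a i = 0 := by
  classical
  set e := Fintype.equivFin ι
  have hli' : LinearIndependent ℚ (l ∘ e.symm) := hli.comp _ e.symm.injective
  have h' : ∑ k, (a ∘ e.symm) k * (l ∘ e.symm) k = 0 := by
    rw [← h]
    exact e.symm.sum_comp (fun j => a j * l j)
  have h0 := RoyWaldschmidt1997.eq_zero_of_sum_algebraic_mul_eq_zero (fun k => hl _) hli'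
    (fun k => ha _) h'
  simpa [e] using congrFun h0 (e i)

/-- **Baker for real numbers**: if `L₁, …, L_m` are `ℚ`-linearly independent real numbers with
`exp Lᵢ` algebraic and `∑ aᵢ Lᵢ = 0` with real algebraic `aᵢ`, then every `aᵢ = 0`
(complexify: `re ∘ ofReal = id` transfers the independence, `Complex.ofReal_exp`).
[cite: Baker1975, Thm 2.1] -/
theorem tateLifting_baker_real {ι : Type*} [Fintype ι] {L a : ι → ℝ}
    (hL : ∀ i, IsAlgebraic ℚ (Real.exp (L i))) (hli : LinearIndependent ℚ L)
    (ha : ∀ i, IsAlgebraic ℚ (a i)) (h : ∑ i, a i * L i = 0) (i : ι) : a i = 0 := by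
  have hl : ∀ k, IsAlgebraic ℚ (Complex.exp ((L k : ℝ) : ℂ)) := fun k => by
    rw [← Complex.ofReal_exp]
    exact (isAlgebraic_algebraMap_iff (R := ℚ) (A := ℂ) Complex.ofReal_injective).mpr (hL k)
  have hli' : LinearIndependent ℚ fun k => ((L k : ℝ) : ℂ) :=
    LinearIndependent.of_comp Complex.reAddGroupHom.toRatLinearMap (by
      simpa only [Function.comp_def, AddMonoidHom.coe_toRatLinearMap,
        Complex.coe_reAddGroupHom, Complex.ofReal_re] using hli)
  have ha' : ∀ k, IsAlgebraic ℚ ((a k : ℝ) : ℂ) := fun k =>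
    (isAlgebraic_algebraMap_iff (R := ℚ) (A := ℂ) Complex.ofReal_injective).mpr (ha k)
  have h' : ∑ k, ((a k : ℝ) : ℂ) * ((L k : ℝ) : ℂ) = 0 := by
    exact_mod_cast congrArg ((↑) : ℝ → ℂ) h
  exact_mod_cast tateLifting_baker_fintype hl hli' ha' h' i

/-- **Baker for real logarithms on a finite set of indices**: if `(log α_j)_{j ∈ J}` is
`ℚ`-linearly independent (`α_j > 0` real algebraic) and `∑_{j ∈ J} a_j log α_j = 0` with real
algebraic `a_j`, then `a_j = 0` for every `j ∈ J`. [cite: Baker1975, Thm 2.1] -/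
theorem tateLifting_baker_real_log {ι : Type*} {α a : ι → ℝ} (J : Finset ι) (hα : ∀ i, 0 < α i)
    (hαa : ∀ i, IsAlgebraic ℚ (α i)) (hli : LinearIndependent ℚ fun j : J => Real.log (α j))
    (ha : ∀ i, IsAlgebraic ℚ (a i)) (h : ∑ j ∈ J, a j * Real.log (α j) = 0) :
    ∀ j ∈ J, a j = 0 := by
  intro j hj
  have h' : ∑ k : J, a k * Real.log (α k) = 0 := by
    rw [Finset.sum_coe_sort J (fun k => a k * Real.log (α k))]
    exact h
  exact tateLifting_baker_real (L := fun k : J => Real.log (α k)) (a := fun k : J => a k)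
    (fun k => by rw [Real.exp_log (hα k)]; exact hαa k) hli (fun k => ha k) h' ⟨j, hj⟩

/-! ### Linear algebra and bookkeeping -/

/-- A finite family of vectors over a division ring has a linearly independent subfamily, indexed
by a `Finset`, spanning every member of the family. [folklore] -/
theorem tateLifting_exists_finset_linearIndependent (K : Type*) {ι M : Type*} [DivisionRing K]
    [AddCommGroup M] [Module K M] [Finite ι] (v : ι → M) :
    ∃ J : Finset ι, LinearIndependent K (fun j : J => v j) ∧
      ∀ i, v i ∈ Submodule.span K (v '' ↑J) := by
  obtain ⟨b, -, -, hsub, hli⟩ :=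
    exists_linearIndepOn_extension (linearIndepOn_empty K v) (Set.empty_subset Set.univ)
  refine ⟨b.toFinite.toFinset, ?_, fun i => ?_⟩
  · have h : LinearIndepOn K v ↑b.toFinite.toFinset := by rwa [Set.Finite.coe_toFinset]
    exact h
  · rw [Set.Finite.coe_toFinset]
    exact hsub ⟨i, Set.mem_univ _, rfl⟩

/-- **Common denominator** of a finite (doubly indexed) family of rationals. [folklore] -/
theorem tateLifting_exists_int_mul_eq {ι κ : Type*} [Finite ι] [Finite κ] (q : ι → κ → ℚ) :
    ∃ (D : ℤ) (n : ι → κ → ℤ), D ≠ 0 ∧ ∀ i j, (n i j : ℚ) = D * q i j := by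
  obtain ⟨b, hb⟩ := IsLocalization.exist_integer_multiples_of_finite (nonZeroDivisors ℤ)
    fun p : ι × κ => q p.1 p.2
  have h : ∀ i j, ∃ z : ℤ, (z : ℚ) = (b : ℤ) * q i j := fun i j => by
    obtain ⟨z, hz⟩ := RingHom.mem_rangeS.mp (hb (i, j))
    exact ⟨z, by simpa [zsmul_eq_mul] using hz⟩
  choose n hn using h
  exact ⟨b, n, nonZeroDivisors.coe_ne_zero b, hn⟩

/-- An **integer additive relation among logarithms** of positive reals is a multiplicative
relation: `∑ mᵢ log αᵢ = 0 ⟹ ∏ αᵢ^{mᵢ} = 1`. [folklore] -/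
theorem tateLifting_prod_zpow_eq_one {ι : Type*} [Fintype ι] {α : ι → ℝ} (hα : ∀ i, 0 < α i)
    (m : ι → ℤ) (h : ∑ i, (m i : ℝ) * Real.log (α i) = 0) : ∏ i, α i ^ m i = 1 := by
  refine Real.eq_one_of_pos_of_log_eq_zero (Finset.prod_pos fun i _ => zpow_pos (hα i) _) ?_
  rw [Real.log_prod fun i _ => (zpow_pos (hα i) _).ne']
  simpa only [Real.log_zpow] using h

/-! ### The decomposition -/

/-- **Baker decomposition** (stub `stub_bakerDecomposition` of line `Sketch` for crux
`TateLifting`): an algebraic-coefficient linear relation among real logarithms of positive real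
algebraic numbers is an algebraic linear combination of integer multiplicative relations.
[cite: Baker1975, Thm 2.1] -/
theorem tateLifting_bakerDecomposition :
    ∀ (s : ℕ) (α w : Fin s → ℝ), (∀ i, 0 < α i) → (∀ i, IsAlgebraic ℚ (α i)) →
      (∀ i, IsAlgebraic ℚ (w i)) → ∑ i, w i * Real.log (α i) = 0 →
      ∃ (t : ℕ) (M : Fin t → Fin s → ℤ) (c : Fin t → ℝ), (∀ q, IsAlgebraic ℚ (c q)) ∧
        (∀ q, ∏ i, α i ^ (M q i) = 1) ∧ ∀ i, w i = ∑ q, c q * (M q i : ℝ) := by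
  intro s α w hα hαa hwa hw
  classical
  -- (1) a maximal `ℚ`-linearly independent subfamily `(log α_j)_{j ∈ J}`
  obtain ⟨J, hJli, hJsp⟩ : ∃ J : Finset (Fin s),
      LinearIndependent ℚ (fun j : J => Real.log (α j)) ∧
        ∀ i, Real.log (α i) ∈ Submodule.span ℚ ((fun k => Real.log (α k)) '' ↑J) :=
    tateLifting_exists_finset_linearIndependent ℚ fun k => Real.log (α k)
  -- rational coordinates `r i j` of `log αᵢ` on the subfamily, zero outside `J`
  obtain ⟨r, hrJ, hr⟩ : ∃ r : Fin s → Fin s → ℚ, (∀ i j, j ∉ J → r i j = 0) ∧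
      ∀ i, ∑ j, (r i j : ℝ) * Real.log (α j) = Real.log (α i) := by
    have hcoef : ∀ i, ∃ c : Fin s → ℚ, ∑ j ∈ J, c j • Real.log (α j) = Real.log (α i) :=
      fun i => (Submodule.mem_span_image_finset_iff_exists_fun' ℚ).mp (hJsp i)
    choose q hq using hcoef
    refine ⟨fun i j => if j ∈ J then q i j else 0, fun i j hj => if_neg hj, fun i => ?_⟩
    calc ∑ j, ((if j ∈ J then q i j else 0 : ℚ) : ℝ) * Real.log (α j)
        = ∑ j ∈ J, ((if j ∈ J then q i j else 0 : ℚ) : ℝ) * Real.log (α j) :=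
          (Finset.sum_subset (Finset.subset_univ J) fun j _ hj => by simp [hj]).symm
      _ = ∑ j ∈ J, q i j • Real.log (α j) :=
          Finset.sum_congr rfl fun j hj => by simp [hj, Rat.smul_def]
      _ = Real.log (α i) := hq i
  -- (2) Baker: every column sum `∑_i wᵢ r_ij` vanishes
  have hbaker : ∀ j, ∑ i, w i * (r i j : ℝ) = 0 := by
    intro j
    by_cases hj : j ∈ J
    · refine tateLifting_baker_real_log (a := fun j => ∑ i, w i * (r i j : ℝ)) J hα hαa hJli
        (fun j => ?_) ?_ j hj
      · exact mem_algebraicClosure_iff.mp (sum_mem fun i _ =>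
          mul_mem (mem_algebraicClosure_iff.mpr (hwa i)) (SubfieldClass.ratCast_mem _ _))
      · have h1 : ∑ j, (∑ i, w i * (r i j : ℝ)) * Real.log (α j) = 0 := by
          calc ∑ j, (∑ i, w i * (r i j : ℝ)) * Real.log (α j)
              = ∑ i, w i * ∑ j, (r i j : ℝ) * Real.log (α j) := by
                simp only [Finset.sum_mul, Finset.mul_sum, mul_assoc]
                exact Finset.sum_comm
            _ = 0 := by simp only [hr]; exact hw
        rw [← h1]
        exact Finset.sum_subset (Finset.subset_univ J) fun j _ hj => by simp [hrJ _ _ hj]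
    · simp [hrJ _ _ hj]
  -- (3) clear denominators
  obtain ⟨D, n, hD, hn⟩ := tateLifting_exists_int_mul_eq r
  have hD' : (D : ℝ) ≠ 0 := by exact_mod_cast hD
  have hn' : ∀ i j, ((n i j : ℤ) : ℝ) = (D : ℝ) * (r i j : ℝ) := fun i j => by
    exact_mod_cast hn i j
  -- (4) the relations `M_i = D e_i − Σ_j n_ij e_j` with coefficients `wᵢ / D`
  refine ⟨s, fun i k => (if k = i then D else 0) - n i k, fun i => w i / D, fun i => ?_,
    fun i => ?_, fun k => ?_⟩
  · exact mem_algebraicClosure_iff.mp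
      (div_mem (mem_algebraicClosure_iff.mpr (hwa i)) (intCast_mem _ D))
  · refine tateLifting_prod_zpow_eq_one hα _ ?_
    calc ∑ k, (((if k = i then D else 0) - n i k : ℤ) : ℝ) * Real.log (α k)
        = D * Real.log (α i) - D * ∑ k, (r i k : ℝ) * Real.log (α k) := by
          simp only [Int.cast_sub, Int.cast_ite, Int.cast_zero, hn', sub_mul,
            Finset.sum_sub_distrib, ite_mul, zero_mul, Finset.sum_ite_eq', Finset.mem_univ,
            if_true, Finset.mul_sum, mul_assoc]
      _ = 0 := by rw [hr i, sub_self]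
  · symm
    calc ∑ i, w i / D * (((if k = i then D else 0) - n i k : ℤ) : ℝ)
        = ∑ i, (if k = i then w i else 0) - ∑ i, w i * (r i k : ℝ) := by
          rw [← Finset.sum_sub_distrib]
          refine Finset.sum_congr rfl fun i _ => ?_
          rw [Int.cast_sub, Int.cast_ite, Int.cast_zero, hn', mul_sub, ← mul_assoc,
            div_mul_cancel₀ _ hD']
          split_ifs
          · rw [div_mul_cancel₀ _ hD']
          · rw [mul_zero]
      _ = w k := by rw [Finset.sum_ite_eq, if_pos (Finset.mem_univ _), hbaker k, sub_zero]

end Summit.KontsevichZagierPeriods.InverseLandau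

end
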